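import Literature.MathematicalPhysics.KineticTheory.RegularStationaryState

/-!
# Tangent tightness, I: minimal-image geometry of the blow-up (line `FirstLemma`, crux stmt-AtomisticToContinuum-14135)

Helper file of the registered stub `stub_tangentTightness : TangentTightness` (idea `kifer-compactification`,
`…KiferTangent.lean`), namespace `Summit.AtomisticToContinuum.HydrodynamicLimit.Theorems.KiferCompactification`.
Deterministic geometry of OVY's blow-up `blowUp ε x z` (`RegularStationaryState.lean` §OVY) of a torus hard-sphere
configuration:

* `norm_reprSym_le_of_proj_eq`: the symmetric representative `Torus.reprSym w ∈ (-1/2, 1/2]³` is a representative of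
  MINIMAL Euclidean norm (coordinatewise the quotient norm of `ℝ/ℤ`), hence
  `‖reprSym (a - b)‖ ≤ ‖reprSym a - reprSym b‖` (`norm_reprSym_sub_le`);
* `stub_isHardCore_blowUp` (REGISTERED stub): the blow-up at scale `ε` of a configuration of the hard-sphere domain
  `D_ε` is a `1`-hard-core configuration of `ℝ³ × ℝ³` (`IsHardCore 1`), and the labelled blow-up is injective
  (`injective_blowUpPoint`) — so label sums equal configuration sums;
* `blowUp_seam` (the SEAM LEMMA): for `f` supported in `{‖position‖ ≤ R}` and `2ε(R + ‖a‖) < 1`,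
  `f (ε⁻¹ reprSym w + a, v) = f (ε⁻¹ reprSym (w + proj (ε a)), v)` — shifting the blown-up position by `a` is EXACTLY
  shifting the torus base point by `proj (ε a)`: the two differ only across the seam of the fundamental domain, where
  both positions have norm `> R`;
* `measurableSet_setOf_isHardCore`: the hard-core event is measurable for the count σ-algebra (its complement is a
  countable union over pairs of basic open sets of `{N(C) ≥ 1} ∩ {N(C') ≥ 1}`).

No new definitions. References: Olla–Varadhan–Yau 1993 §3 (blow-up), Kallenberg 2002 Ch. 16 (context).
-/

noncomputable section

open MeasureTheory Set Filter Topology Function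
open scoped ENNReal NNReal

namespace Summit.AtomisticToContinuum.HydrodynamicLimit.Theorems.KiferCompactification

open Literature.MathematicalPhysics.KineticTheory (T3 V3 blowUpPoint blowUp)
open Literature.Analysis.FluidPDE (Config IsHardCore hardSphereDomain)
open Literature.Analysis.FunctionSpaces (PointConfig)
open Literature.Analysis.FluidPDE.Torus (reprSym)
open Literature.Analysis.FunctionSpaces.Torus (proj)

/-! ## The symmetric representative is norm-minimal -/

/-- Coordinates of the symmetric representative are at most `1/2` in absolute value. -/
theorem abs_reprSym_apply_le_half (w : T3) (i : Fin 3) : |reprSym w i| ≤ 1 / 2 := by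
  have h := Literature.Analysis.FluidPDE.Torus.reprSym_apply_mem_Ioc w i
  exact abs_le.2 ⟨by linarith [h.1], h.2⟩

/-- The symmetric representative is a representative of minimal Euclidean norm: `proj r = w → ‖reprSym w‖ ≤ ‖r‖`
(coordinatewise `|reprSym w i| = ‖w i‖_{ℝ/ℤ} ≤ |r i|`, the quotient norm). -/
theorem norm_reprSym_le_of_proj_eq {w : T3} {r : V3} (h : proj r = w) : ‖reprSym w‖ ≤ ‖r‖ := by
  rw [EuclideanSpace.norm_eq, EuclideanSpace.norm_eq]
  refine Real.sqrt_le_sqrt (Finset.sum_le_sum fun i _ => ?_)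
  refine pow_le_pow_left₀ (norm_nonneg _) ?_ 2
  rw [Real.norm_eq_abs, Real.norm_eq_abs, Literature.Analysis.FluidPDE.Torus.abs_reprSym_apply, ← h,
    Literature.Analysis.FunctionSpaces.Torus.proj_apply]
  have := QuotientAddGroup.norm_mk_le_norm (S := AddSubgroup.zmultiples (1 : ℝ)) (m := r i)
  simpa using this

/-- Minimal-image distances are dominated by distances of symmetric representatives:
`‖reprSym (a - b)‖ ≤ ‖reprSym a - reprSym b‖`. -/
theorem norm_reprSym_sub_le (a b : T3) : ‖reprSym (a - b)‖ ≤ ‖reprSym a - reprSym b‖ :=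
  norm_reprSym_le_of_proj_eq (by
    rw [sub_eq_add_neg, Literature.Analysis.FunctionSpaces.Torus.proj_add,
      Literature.Analysis.FunctionSpaces.Torus.proj_neg, Literature.Analysis.FluidPDE.Torus.proj_reprSym,
      Literature.Analysis.FluidPDE.Torus.proj_reprSym, ← sub_eq_add_neg])

/-! ## Hard core of the blow-up -/

/-- Blown-up positions (scale `ε > 0`, any base point `x`) of two torus particles at minimal-image distance `≥ ε`
are `1`-separated. -/
theorem one_le_norm_blowUpPoint_fst_sub {ε : ℝ} (hε : 0 < ε) (x : T3) {p q : T3 × V3}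
    (h : ε ≤ ‖reprSym (p.1 - q.1)‖) :
    1 ≤ ‖(blowUpPoint ε x p).1 - (blowUpPoint ε x q).1‖ := by
  simp only [blowUpPoint, ← smul_sub, norm_smul, Real.norm_eq_abs, abs_inv, abs_of_pos hε]
  rw [le_inv_mul_iff₀ hε, mul_one]
  refine h.trans ((le_of_eq ?_).trans (norm_reprSym_sub_le (p.1 - x) (q.1 - x)))
  rw [sub_sub_sub_cancel_right]

/-- **The blow-up of a hard-sphere configuration is a unit-hard-core configuration**: for `ε > 0`, any base point
`x ∈ 𝕋³` and `z` in the hard-sphere domain `D_ε` of the torus geometry, distinct points of `blowUp ε x z` have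
positions at distance `≥ 1`. Registered stub `stub_isHardCore_blowUp` of line `FirstLemma`
(crux stmt-AtomisticToContinuum-14135), helper of `stub_tangentTightness`. -/
theorem stub_isHardCore_blowUp {ε : ℝ} (hε : 0 < ε) (x : T3) {N : ℕ} {z : Config N (Fin 3) T3}
    (hz : z ∈ hardSphereDomain (Literature.Analysis.FluidPDE.Torus.geometry (Fin 3)) N ε) :
    IsHardCore 1 (blowUp ε x z) := by
  intro p hp q hq hpq
  obtain ⟨i, rfl⟩ := Literature.MathematicalPhysics.KineticTheory.mem_blowUp.1 hp
  obtain ⟨j, rfl⟩ := Literature.MathematicalPhysics.KineticTheory.mem_blowUp.1 hq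
  have hij : i ≠ j := fun h => hpq (by rw [h])
  exact one_le_norm_blowUpPoint_fst_sub hε x (hz i j hij)

/-- The labelled blow-up `i ↦ blowUpPoint ε x (z i)` of a configuration of the hard-sphere domain is injective
(`ε > 0`), so that label sums `∑ᵢ f (blowUpPoint ε x (z i))` are configuration sums over `blowUp ε x z`. -/
theorem injective_blowUpPoint {ε : ℝ} (hε : 0 < ε) (x : T3) {N : ℕ} {z : Config N (Fin 3) T3}
    (hz : z ∈ hardSphereDomain (Literature.Analysis.FluidPDE.Torus.geometry (Fin 3)) N ε) :
    Injective fun i => blowUpPoint ε x (z i) := by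
  intro i j hij
  by_contra hne
  have h := one_le_norm_blowUpPoint_fst_sub hε x (hz i j hne)
  simp only at hij
  rw [hij, sub_self, norm_zero] at h
  exact absurd h (by norm_num)

/-! ## The seam lemma -/

/-- **The seam lemma.** For a test function `f` supported in `{‖position‖ ≤ R}` and `2ε(R + ‖a‖) < 1`,
shifting the blown-up position by `a` is the same as shifting the torus point by `proj (ε a)`:
`f (ε⁻¹ reprSym w + a, v) = f (ε⁻¹ reprSym (w + proj (ε a)), v)`. The two position arguments differ by `ε⁻¹` times
a lattice vector; when it is nonzero (the seam of the fundamental domain is crossed) both have norm `> R`. -/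
theorem blowUp_seam {ε R : ℝ} (hε : 0 < ε) {a : V3} (hR : 2 * ε * (R + ‖a‖) < 1) {f : V3 × V3 → ℝ}
    (hf : ∀ p, f p ≠ 0 → ‖p.1‖ ≤ R) (w : T3) (v : V3) :
    f (ε⁻¹ • reprSym w + a, v) = f (ε⁻¹ • reprSym (w + proj (ε • a)), v) := by
  set r := reprSym w with hr
  set r' := reprSym (w + proj (ε • a)) with hr'
  have hproj : proj (r + ε • a) = proj r' := by
    rw [Literature.Analysis.FunctionSpaces.Torus.proj_add, hr, hr',
      Literature.Analysis.FluidPDE.Torus.proj_reprSym, Literature.Analysis.FluidPDE.Torus.proj_reprSym]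
  obtain ⟨k, hk⟩ := (Literature.Analysis.FunctionSpaces.Torus.proj_eq_proj_iff_holds _ _).1 hproj
  have hRa : R + ‖a‖ < ε⁻¹ / 2 := by
    rw [lt_div_iff₀ two_pos, ← mul_lt_mul_iff_of_pos_left hε, ← mul_assoc, mul_comm _ 2,
      mul_inv_cancel₀ hε.ne']
    linarith
  by_cases hk0 : k = 0
  · rw [hk0, Literature.Analysis.FunctionSpaces.Torus.latticeVec_zero, add_zero] at hk
    rw [hk, smul_add, inv_smul_smul₀ hε.ne']
  · obtain ⟨j, hj⟩ : ∃ j, k j ≠ 0 := by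
      by_contra hcon
      push Not at hcon
      exact hk0 (funext hcon)
    have hkj : (1 : ℝ) ≤ |(k j : ℝ)| := by
      rw [← Int.cast_abs]
      exact_mod_cast Int.one_le_abs hj
    have hcoord : r' j = r j + ε * a j + k j := by
      have := congrArg (fun u : V3 => u j) hk
      simpa using this
    have hrj := abs_reprSym_apply_le_half w j
    have hr'j := abs_reprSym_apply_le_half (w + proj (ε • a)) j
    rw [← hr] at hrj
    rw [← hr'] at hr'j
    have haj : |a j| ≤ ‖a‖ := by simpa using PiLp.norm_apply_le a j
    have hεa : ε * |a j| ≤ ε * ‖a‖ := mul_le_mul_of_nonneg_left haj hε.le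
    -- both sides vanish: the left position is `ε⁻¹ (r' - k)`, the right one is `ε⁻¹ r'`, both of norm `> R`
    have h1 : f (ε⁻¹ • r + a, v) = 0 := by
      by_contra hne
      have hle := hf _ hne
      simp only at hle
      have hsum : ε⁻¹ • r + a = ε⁻¹ • (r + ε • a) := by rw [smul_add, inv_smul_smul₀ hε.ne']
      rw [hsum, norm_smul, Real.norm_eq_abs, abs_inv, abs_of_pos hε] at hle
      have hc : |(r + ε • a) j| ≤ ‖r + ε • a‖ := by simpa using PiLp.norm_apply_le (r + ε • a) j
      have hc' : (r + ε • a) j = r' j - k j := by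
        rw [hcoord]; simp
      rw [hc'] at hc
      have h3 : (1 : ℝ) / 2 ≤ |r' j - k j| := by
        have := abs_sub_abs_le_abs_sub (k j : ℝ) (r' j)
        rw [abs_sub_comm] at this
        linarith
      have h4 : ε⁻¹ * (1 / 2) ≤ R := ((mul_le_mul_of_nonneg_left (h3.trans hc) (inv_pos.2 hε).le)).trans hle
      linarith [norm_nonneg a]
    have h2 : f (ε⁻¹ • r', v) = 0 := by
      by_contra hne
      have hle := hf _ hne
      simp only at hle
      rw [norm_smul, Real.norm_eq_abs, abs_inv, abs_of_pos hε] at hle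
      have hc : |r' j| ≤ ‖r'‖ := by simpa using PiLp.norm_apply_le r' j
      have h3 : 1 / 2 - ε * ‖a‖ ≤ |r' j| := by
        rw [hcoord]
        have e1 : |(k j : ℝ)| ≤ |r j + ε * a j + k j| + |r j + ε * a j| := by
          have := abs_sub (r j + ε * a j + (k j : ℝ)) (r j + ε * a j)
          rwa [show r j + ε * a j + (k j : ℝ) - (r j + ε * a j) = (k j : ℝ) by ring] at this
        have e2 : |r j + ε * a j| ≤ |r j| + ε * |a j| := by
          calc |r j + ε * a j| ≤ |r j| + |ε * a j| := abs_add_le _ _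
            _ = |r j| + ε * |a j| := by rw [abs_mul, abs_of_pos hε]
        linarith
      have h4 : ε⁻¹ * (1 / 2 - ε * ‖a‖) ≤ R :=
        ((mul_le_mul_of_nonneg_left (h3.trans hc) (inv_pos.2 hε).le)).trans hle
      rw [mul_sub, ← mul_assoc, inv_mul_cancel₀ hε.ne', one_mul] at h4
      linarith
    rw [h1, h2]

/-! ## Measurability of the hard-core event -/

/-- The `δ`-hard-core configurations form a measurable event for the count σ-algebra: the complement is the
countable union, over pairs of basic open sets `C, C'` all of whose pairs of points are distinct with positions
closer than `δ`, of `{N(C) ≥ 1} ∩ {N(C') ≥ 1}`. -/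
theorem measurableSet_setOf_isHardCore (δ : ℝ) :
    MeasurableSet {ω : PointConfig (V3 × V3) | IsHardCore δ ω} := by
  set B := TopologicalSpace.countableBasis (V3 × V3) with hB
  have hBb : TopologicalSpace.IsTopologicalBasis B := TopologicalSpace.isBasis_countableBasis _
  have hBc : B.Countable := TopologicalSpace.countable_countableBasis _
  -- pairs of basic sets witnessing a violation of the hard core
  let bad : Set (V3 × V3) → Set (V3 × V3) → Prop := fun C C' =>
    ∀ a ∈ C, ∀ b ∈ C', a ≠ b ∧ ‖a.1 - b.1‖ < δ
  have hrepr : {ω : PointConfig (V3 × V3) | IsHardCore δ ω}ᶜ =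
      ⋃ C ∈ B, ⋃ C' ∈ B, {ω | bad C C' ∧ 1 ≤ ω.count C ∧ 1 ≤ ω.count C'} := by
    ext ω
    simp only [mem_compl_iff, mem_setOf_eq, mem_iUnion, exists_prop]
    constructor
    · intro hω
      have hex : ∃ p ∈ ω, ∃ q ∈ ω, p ≠ q ∧ ‖p.1 - q.1‖ < δ := by
        by_contra hcon
        push Not at hcon
        exact hω fun p hp q hq hpq => hcon p hp q hq hpq
      obtain ⟨p, hp, q, hq, hpq, hdist⟩ := hex
      obtain ⟨U, V, hU, hV, hpU, hqV, hUV⟩ := t2_separation hpq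
      set r := (δ - ‖p.1 - q.1‖) / 2 with hr
      have hr0 : 0 < r := by rw [hr]; linarith
      obtain ⟨C, hCB, hpC, hCU⟩ := hBb.exists_subset_of_mem_open (a := p) (u := U ∩ Metric.ball p r)
        ⟨hpU, Metric.mem_ball_self hr0⟩ (hU.inter Metric.isOpen_ball)
      obtain ⟨C', hC'B, hqC', hC'V⟩ := hBb.exists_subset_of_mem_open (a := q) (u := V ∩ Metric.ball q r)
        ⟨hqV, Metric.mem_ball_self hr0⟩ (hV.inter Metric.isOpen_ball)
      refine ⟨C, hCB, C', hC'B, ?_, ?_, ?_⟩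
      · intro a ha b hb
        refine ⟨fun hab => ?_, ?_⟩
        · exact Set.disjoint_left.1 hUV (hCU ha).1 (hab ▸ (hC'V hb).1)
        · have ha' : ‖a.1 - p.1‖ < r := by
            have h1 := (hCU ha).2
            rw [Metric.mem_ball, dist_eq_norm] at h1
            exact (norm_fst_le (a - p)).trans_lt h1
          have hb' : ‖q.1 - b.1‖ < r := by
            have h1 := (hC'V hb).2
            rw [Metric.mem_ball, dist_comm, dist_eq_norm] at h1
            exact (norm_fst_le (q - b)).trans_lt h1
          calc ‖a.1 - b.1‖ = ‖(a.1 - p.1) + (p.1 - q.1) + (q.1 - b.1)‖ := by congr 1; abel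
            _ ≤ ‖a.1 - p.1‖ + ‖p.1 - q.1‖ + ‖q.1 - b.1‖ := norm_add₃_le
            _ < r + ‖p.1 - q.1‖ + r := by linarith
            _ = δ := by rw [hr]; ring
      · exact Set.one_le_encard_iff_nonempty.2 ⟨p, hp, hpC⟩
      · exact Set.one_le_encard_iff_nonempty.2 ⟨q, hq, hqC'⟩
    · rintro ⟨C, -, C', -, hbad, hC, hC'⟩ hω
      obtain ⟨a, ha, haC⟩ := Set.one_le_encard_iff_nonempty.1 hC
      obtain ⟨b, hb, hbC'⟩ := Set.one_le_encard_iff_nonempty.1 hC'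
      obtain ⟨hab, hlt⟩ := hbad a haC b hbC'
      exact absurd (hω a ha b hb hab) (not_le.2 hlt)
  have hmeas : MeasurableSet {ω : PointConfig (V3 × V3) | IsHardCore δ ω}ᶜ := by
    rw [hrepr]
    refine MeasurableSet.biUnion hBc fun C hC => MeasurableSet.biUnion hBc fun C' hC' => ?_
    have hCm : MeasurableSet C := (hBb.isOpen hC).measurableSet
    have hC'm : MeasurableSet C' := (hBb.isOpen hC').measurableSet
    have h1 : MeasurableSet {ω : PointConfig (V3 × V3) | 1 ≤ ω.count C} :=
      (PointConfig.measurable_count hCm) (MeasurableSpace.measurableSet_top : MeasurableSet (Ici (1 : ℕ∞)))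
    have h2 : MeasurableSet {ω : PointConfig (V3 × V3) | 1 ≤ ω.count C'} :=
      (PointConfig.measurable_count hC'm) (MeasurableSpace.measurableSet_top : MeasurableSet (Ici (1 : ℕ∞)))
    by_cases hbad : bad C C'
    · have : {ω : PointConfig (V3 × V3) | bad C C' ∧ 1 ≤ ω.count C ∧ 1 ≤ ω.count C'} =
          {ω | 1 ≤ ω.count C} ∩ {ω | 1 ≤ ω.count C'} := by
        ext ω; simp [hbad]
      rw [this]
      exact h1.inter h2
    · have : {ω : PointConfig (V3 × V3) | bad C C' ∧ 1 ≤ ω.count C ∧ 1 ≤ ω.count C'} = ∅ := by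
        ext ω; simp [hbad]
      rw [this]
      exact MeasurableSet.empty
  exact MeasurableSet.of_compl hmeas

end Summit.AtomisticToContinuum.HydrodynamicLimit.Theorems.KiferCompactification
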